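import Literature.NumberTheory.LFunctions.GaussianRayHeckeZFRInputs
import Literature.NumberTheory.LFunctions.LogDerivPackage
import HarnessLib

/-!
# The zero-free region (16.20) for the Hecke `L`-functions `L(s, ψ)` of `ℚ(i)` modulo `M`, `ψ = χ (z/|z|)^k`, `k ≥ 1`

Topic `Literature/NumberTheory/LFunctions`, sequel to `GaussianRayHeckeZFRInputs.lean`. Everything is
PROVED; no named facts.

J. Friedlander, H. Iwaniec, Ann. of Math. 148 (1998), §16, after (16.19): "We also need a zero-free
region for `L(s, ψ)`. It follows from the above bounds by classical arguments that there are no zeros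
for `s = σ + it` with (16.20) `σ > 1 - c/log(4d + |m| + |t|)` where `c` is a positive absolute
constant, apart from a possible exceptional simple real zero in the case that `ψ` is real."

Here: the case `k ≥ 1` (`m ≠ 0` in FI's notation; then `ψ²` has frequency `2k ≠ 0`, so `L(s, ψ²)` is
entire and there is no exceptional zero). The "classical argument" is Montgomery–Vaughan's Theorem 11.3
in the tree's abstract form `TwistedZFRData` (`TwistedZeroFreeRegion.lean`); we verify its fields with
ABSOLUTE numeric parameters and the conductor parameter `Q = M(k + 2)`:

* `nS = ∑_{x} N(x)^{-3/2}` (`C_g`), `lower_heckeL` (`c₁ = (4⁶ nS)⁻¹`: `‖L(s,ψ)‖ ≥ ‖L(σ, 1 mod 4)‖⁻¹ ≥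
  (σ-1)/(4⁶ nS)` through `‖(s-1)ζ_K^{odd}‖ ≤ 4⁶ nS` on `[1, 2]`), `growth_heckeL`
  (`‖L(s,ψ)‖ ≤ nS (M(k+2))³ (|t|+4)³` for `-1/2 ≤ σ ≤ 3`, from `norm_heckeL_le`),
  **`logDerivPackage_heckeL`** (`LogDerivPackage 1 3 nS c₁ (M(k+2)) l_ψ (heckeL M χ k)`);
* `K0` (from `exists_re_LSeries_Lam0_le`), `Epkg`, `C2 = 2(E + 32/3 + K₀)`, `log_Q2_le`,
  **`re_LSeries₂_le_heckeL`** — the companion bound `Re L(l_{ψ²}, s) ≤ C₂(log Q + log(|t|+4))`,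
  `1 < σ ≤ 2`, from the growth package of `L(s, ψ²) = heckeL M χ² (2k)`
  (`LogDerivPackage.re_LSeries_le_of_majorant`, MV (11.2));
* **`twistedZFRData_heckeL`** — `TwistedZFRData 1 3 nS c₁ K₀ C₂ false (M(k+2)) Λ₀ l_ψ l_{ψ²} (heckeL M χ k)`
  for `4 ∣ M`, `k ≥ 1`;
* **`exists_zeroFree_heckeL`** — there is an absolute `c > 0` such that for all `M` (`4 ∣ M`), `χ`,
  `k ≥ 1`: every zero `ρ` of `L(s, ψ) = heckeL M χ k` has `Re ρ ≤ 1 - c/(log(M(k+2)) + log(|Im ρ|+4))`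
  (`TwistedZFRData.exists_zeroFree_const`; `log(M(k+2)) + log(|t|+4) ≍ log(4d + |m| + |t|)`).

The case `k = 0` (characters `χ` of `(ℤ[i]/4d)ˣ`, with the exceptional real zero for real `χ` and
Siegel's bound, FI Lemma 16.1) is the sequel.

## References

* J. Friedlander, H. Iwaniec, Ann. of Math. (2) 148 (1998), 945–1040, §16 (16.20). [FriedlanderIwaniecAnnals1998]
* H. L. Montgomery, R. C. Vaughan, *Multiplicative Number Theory I*, CUP 2007, §11.1 Theorem 11.3.
  [MontgomeryVaughan2007]

## Mathlib / tree

Tree: `TwistedZFRData`, `TwistedZFRData.exists_zeroFree_const` (`TwistedZeroFreeRegion`);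
`LogDerivPackage`, `LogDerivPackage.re_LSeries_le_of_majorant` (`LogDerivPackage`); everything of
`GaussianRayHeckeZFRInputs` (`heckeL_ne_zero`, `deriv_heckeL_div`, `norm_heckeL_ge_inv`, `Lam0`,
`exists_re_LSeries_Lam0_le`, `norm_lCoeffP_le_Lam0`, `three_four_one`, `psi_zero_or_norm_one`,
`zetaOddE_eq`, `norm_zetaOddE_le`, `psiSq_psi`); `norm_heckeL_le`, `differentiable_heckeL`
(`GaussianRayHeckeL`); `GaussianHecke.normSum_pos`.
-/

noncomputable section

open Complex Real Filter Topology Asymptotics Set MeasureTheory Finset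
open scoped Nat

namespace Literature.NumberTheory.LFunctions

namespace GaussianCosetTheta

local notation "ℤ[i]" => GaussianInt

variable {M : ℕ} [NeZero M]

open Literature.NumberTheory.QuadraticFields.GaussianPrimary (IsPrimary isPrimary_iff_dvd primaryNormEq mem_primaryNormEq)
open Literature.NumberTheory.Sieve.FriedlanderIwaniecPrimes (GaussQuot toQuot toQuot_eq_toQuot_iff isUnit_toQuot_of_coprime)
open GaussianPrimaryVM LSeries

/-! ### The absolute constant `normSum(3/2)` -/

/-- The absolute constant `S = ∑_{x ∈ ℤ[i]} N(x)^{-3/2}` (`> 0`) of the convexity bounds. [folklore] -/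
def nS : ℝ := ∑' x : ℤ[i], ((x.norm : ℤ) : ℝ) ^ (-(3 / 2 : ℝ))

/-- `S > 0`. [folklore] -/
theorem nS_pos : 0 < nS := GaussianHecke.normSum_pos (by norm_num)

/-! ### The lower bound field -/

/-- `‖Z(σ)‖ ≤ 4⁶ S` for `1 < σ ≤ 2` (`Z = zetaOddE`). [folklore] -/
theorem norm_zetaOddE_le_const {σ : ℝ} (hσ : 1 < σ) (hσ2 : σ ≤ 2) : ‖zetaOddE σ‖ ≤ (4 : ℝ) ^ 6 * nS := by
  have h := norm_zetaOddE_le (s := (σ : ℂ)) (by simp; linarith)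
  have hX : ‖(2 : ℂ) + σ‖ ≤ 4 := by
    have : (2 : ℂ) + σ = ((2 + σ : ℝ) : ℂ) := by push_cast; ring
    rw [this, Complex.norm_real, Real.norm_of_nonneg (by linarith)]
    linarith
  calc ‖zetaOddE σ‖ ≤ ((4 : ℝ) ^ 3 * nS) * ‖(2 : ℂ) + σ‖ ^ 3 := h
    _ ≤ ((4 : ℝ) ^ 3 * nS) * 4 ^ 3 := by
        have := nS_pos
        gcongr
    _ = (4 : ℝ) ^ 6 * nS := by ring

/-- `‖L(σ, 1 mod 4)‖ ≤ 4⁶ S / (σ - 1)` for `1 < σ ≤ 2`. [folklore] -/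
theorem norm_heckeL_four_one_le {σ : ℝ} (hσ : 1 < σ) (hσ2 : σ ≤ 2) :
    ‖heckeL 4 1 0 (σ : ℂ)‖ ≤ (4 : ℝ) ^ 6 * nS / (σ - 1) := by
  have hs0 : (σ : ℂ) ≠ 0 := by exact_mod_cast (show σ ≠ 0 by linarith)
  have hs1 : (σ : ℂ) ≠ 1 := by exact_mod_cast (show σ ≠ 1 by linarith)
  have hZ := zetaOddE_eq hs0 hs1
  have h1 : heckeL 4 1 0 (σ : ℂ) = zetaOddE σ / ((σ : ℂ) - 1) := by
    rw [hZ, mul_div_cancel_left₀ _ (sub_ne_zero.mpr hs1)]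
  rw [h1, norm_div, show ((σ : ℂ) - 1) = ((σ - 1 : ℝ) : ℂ) by push_cast; ring, Complex.norm_real,
    Real.norm_of_nonneg (by linarith)]
  exact div_le_div_of_nonneg_right (norm_zetaOddE_le_const hσ hσ2) (by linarith)

/-- **Field `lower`**: `(4⁶ S)⁻¹ (σ - 1) ≤ ‖L(s, ψ)‖` for `1 < σ ≤ 2` (`4 ∣ M`).
[cite: MontgomeryVaughan2007, §11.1 Theorem 11.3 (hypotheses)] -/
theorem lower_heckeL (h4 : 4 ∣ M) (χ : MulChar (GaussQuot M) ℂ) (k : ℕ) {s : ℂ} (hs : 1 < s.re) (hs2 : s.re ≤ 2) :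
    ((4 : ℝ) ^ 6 * nS)⁻¹ * (s.re - 1) ≤ ‖heckeL M χ k s‖ := by
  have hpos : 0 < (4 : ℝ) ^ 6 * nS := by have := nS_pos; positivity
  have h1 := norm_heckeL_ge_inv h4 χ k hs
  have h2 := norm_heckeL_four_one_le hs hs2
  have hσ1 : 0 < s.re - 1 := by linarith
  have hne : 0 < ‖heckeL 4 1 0 (s.re : ℂ)‖ :=
    norm_pos_iff.mpr (heckeL_ne_zero (dvd_refl 4) 1 0 (by simp [hs]))
  calc ((4 : ℝ) ^ 6 * nS)⁻¹ * (s.re - 1) = ((4 : ℝ) ^ 6 * nS / (s.re - 1))⁻¹ := by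
        field_simp
    _ ≤ ‖heckeL 4 1 0 (s.re : ℂ)‖⁻¹ := by
        rw [inv_le_inv₀ (by positivity) hne]
        exact h2
    _ ≤ ‖heckeL M χ k s‖ := h1

/-! ### The growth field (`k ≥ 1`) -/

/-- `‖(k/2 + 1) + s‖ ≤ (k + 2)(|t| + 4)` for `Re s ≤ 3` and `Re s ≥ -1/2`. [folklore] -/
theorem norm_shift_le (k : ℕ) {s : ℂ} (hs1 : -1 / 2 ≤ s.re) (hs3 : s.re ≤ 3) :
    ‖((k : ℂ) / 2 + 1) + s‖ ≤ ((k : ℝ) + 2) * (|s.im| + 4) := by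
  have hk : (0 : ℝ) ≤ k := Nat.cast_nonneg k
  refine (Complex.norm_le_abs_re_add_abs_im _).trans ?_
  have hre : |(((k : ℂ) / 2 + 1) + s).re| ≤ (k : ℝ) / 2 + 4 := by
    have h1 : (((k : ℂ) / 2 + 1) + s).re = (k : ℝ) / 2 + 1 + s.re := by simp [add_re]
    rw [h1, abs_le]; constructor <;> linarith
  have him : |(((k : ℂ) / 2 + 1) + s).im| = |s.im| := by simp
  rw [him]
  nlinarith [abs_nonneg s.im]

/-- **Field `growth`, `k ≥ 1`**: `‖L(s, ψ)‖ ≤ S · (M(k+2))³ (|t| + 4)³` for `-1/2 ≤ Re s ≤ 3`.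
[cite: FriedlanderIwaniecAnnals1998, (16.18)] -/
theorem growth_heckeL (χ : MulChar (GaussQuot M) ℂ) {k : ℕ} (hk : k ≠ 0) {s : ℂ} (hs1 : -1 / 2 ≤ s.re) (hs3 : s.re ≤ 3) :
    ‖heckeL M χ k s‖ ≤ nS * ((M : ℝ) * (k + 2)) ^ (3 : ℝ) * (|s.im| + 4) ^ (3 : ℝ) := by
  have hM1 : (1 : ℝ) ≤ M := by exact_mod_cast Nat.one_le_iff_ne_zero.mpr (NeZero.ne M)
  have hk0 : (0 : ℝ) ≤ k := Nat.cast_nonneg k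
  have h := norm_heckeL_le (M := M) χ hk hs1
  have hX := norm_shift_le k hs1 hs3
  have ht : (0 : ℝ) ≤ |s.im| + 4 := by positivity
  have h4 : (1 : ℝ) ≤ |s.im| + 4 := by linarith [abs_nonneg s.im]
  rw [show ((3 : ℝ)) = ((3 : ℕ) : ℝ) by norm_num, Real.rpow_natCast, Real.rpow_natCast]
  calc ‖heckeL M χ k s‖ ≤ ((M : ℝ) ^ 3 * nS) * ‖((k : ℂ) / 2 + 1) + s‖ ^ 2 := h
    _ ≤ ((M : ℝ) ^ 3 * nS) * (((k : ℝ) + 2) * (|s.im| + 4)) ^ 2 := by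
        have := nS_pos; gcongr
    _ ≤ nS * ((M : ℝ) * (k + 2)) ^ 3 * (|s.im| + 4) ^ 3 := by
        have hnS := nS_pos
        have h1 : ((k : ℝ) + 2) ^ 2 ≤ ((k : ℝ) + 2) ^ 3 := by nlinarith
        have h2 : (|s.im| + 4) ^ 2 ≤ (|s.im| + 4) ^ 3 := by nlinarith
        calc ((M : ℝ) ^ 3 * nS) * (((k : ℝ) + 2) * (|s.im| + 4)) ^ 2
            = nS * (M : ℝ) ^ 3 * (((k : ℝ) + 2) ^ 2 * (|s.im| + 4) ^ 2) := by ring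
          _ ≤ nS * (M : ℝ) ^ 3 * (((k : ℝ) + 2) ^ 3 * (|s.im| + 4) ^ 3) := by gcongr
          _ = nS * ((M : ℝ) * (k + 2)) ^ 3 * (|s.im| + 4) ^ 3 := by ring

/-- **The growth package of `L(s, ψ)`, `k ≥ 1`** (`LogDerivPackage` with `η = 1`, `A = 3`,
`C_g = S`, `c₁ = (4⁶S)⁻¹`, `Q = M(k+2)`, `Λ = l_ψ`). [cite: MontgomeryVaughan2007, §11.1 Lemma 11.1 (hypotheses)] -/
theorem logDerivPackage_heckeL (h4 : 4 ∣ M) (χ : MulChar (GaussQuot M) ℂ) {k : ℕ} (hk : k ≠ 0) :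
    LogDerivPackage 1 3 nS ((4 : ℝ) ^ 6 * nS)⁻¹ ((M : ℝ) * (k + 2)) (lCoeffP (psi M χ k)) (heckeL M χ k) where
  eta_pos := one_pos
  eta_le_one := le_rfl
  A_nonneg := by norm_num
  Cg_pos := nS_pos
  c₁_pos := by have := nS_pos; positivity
  one_le_Q := by
    have hM1 : (1 : ℝ) ≤ M := by exact_mod_cast Nat.one_le_iff_ne_zero.mpr (NeZero.ne M)
    have hk0 : (0 : ℝ) ≤ k := Nat.cast_nonneg k
    nlinarith
  differentiableOn := (differentiable_heckeL χ hk).differentiableOn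
  ne_zero := fun s hs ↦ heckeL_ne_zero h4 χ k hs
  logDeriv_eq := fun s hs ↦ by rw [deriv_heckeL_div h4 χ k hs]; rfl
  growth := fun s hs1 hs3 ↦ growth_heckeL χ hk (by linarith) hs3
  lower := fun s hs hs2 ↦ lower_heckeL h4 χ k hs hs2

/-! ### The constants `K₀`, `E`, `C₂` -/

/-- The constant `K₀ ≥ 0` of `Re L(Λ₀, σ) ≤ 1/(σ-1) + K₀` (from the odd-ideal zeta datum). [folklore] -/
def K0 : ℝ := Classical.choose exists_re_LSeries_Lam0_le

/-- `K₀ ≥ 0`. [folklore] -/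
theorem K0_nonneg : 0 ≤ K0 := (Classical.choose_spec exists_re_LSeries_Lam0_le).1

/-- `Re L(Λ₀, σ) ≤ 1/(σ-1) + K₀` for `1 < σ ≤ 2`. [folklore] -/
theorem re_LSeries_Lam0_le {σ : ℝ} (hσ : 1 < σ) (hσ2 : σ ≤ 2) :
    (LSeries (fun n ↦ ((Lam0 n : ℝ) : ℂ)) σ).re ≤ 1 / (σ - 1) + K0 :=
  (Classical.choose_spec exists_re_LSeries_Lam0_le).2 σ hσ hσ2

/-- The package constant `E = E(1, 3, S, (4⁶S)⁻¹)` of `LogDerivPackage`/`TwistedZFRData` for our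
parameters. [folklore] -/
def Epkg : ℝ := (8 * (2 * (3 : ℝ) + |Real.log (nS / (((4 : ℝ) ^ 6 * nS)⁻¹ * ((1 : ℝ) / 32)))| + 1) / ((1 : ℝ) / 4))

/-- `E ≥ 0`. [folklore] -/
theorem Epkg_nonneg : 0 ≤ Epkg := by unfold Epkg; positivity

/-- The constant `C₂ = 2 (E + 32/3 + K₀)` of the companion bound. [folklore] -/
def C2 : ℝ := 2 * (Epkg + 32 / (3 * (1 : ℝ)) + K0)

/-- `C₂ ≥ 0`. [folklore] -/
theorem C2_nonneg : 0 ≤ C2 := by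
  have := Epkg_nonneg; have := K0_nonneg; unfold C2; positivity

/-- `log(M(2k+2)) + ℓ ≤ 2 (log(M(k+2)) + ℓ)` for `ℓ = log(|t| + 4)` (`log 2 ≤ log 4 ≤ ℓ`). [folklore] -/
theorem log_Q2_le (k : ℕ) (t : ℝ) :
    Real.log ((M : ℝ) * ((2 * k : ℕ) + 2)) + Real.log (|t| + 4) ≤
      2 * (Real.log ((M : ℝ) * (k + 2)) + Real.log (|t| + 4)) := by
  have hM1 : (1 : ℝ) ≤ M := by exact_mod_cast Nat.one_le_iff_ne_zero.mpr (NeZero.ne M)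
  have hk0 : (0 : ℝ) ≤ k := Nat.cast_nonneg k
  have hQ : (1 : ℝ) ≤ (M : ℝ) * (k + 2) := by nlinarith
  have h1 : Real.log ((M : ℝ) * ((2 * k : ℕ) + 2)) ≤ Real.log 2 + Real.log ((M : ℝ) * (k + 2)) := by
    rw [← Real.log_mul (by norm_num) (by positivity)]
    apply Real.log_le_log (by positivity)
    push_cast; nlinarith
  have h2 : Real.log 2 ≤ Real.log (|t| + 4) := Real.log_le_log (by norm_num) (by linarith [abs_nonneg t])
  have h3 : 0 ≤ Real.log ((M : ℝ) * (k + 2)) := Real.log_nonneg hQ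
  linarith

/-- **Field `re_LSeries₂_le`, `k ≥ 1`**: `Re L(l_{ψ²}, s) ≤ C₂ (log(M(k+2)) + log(|t|+4))` for `1 < σ ≤ 2`
(the companion `L(s, ψ²)`, frequency `2k ≥ 2`, has no pole; MV (11.2) for its growth package).
[cite: MontgomeryVaughan2007, §11.1 Theorem 11.3 (proof, (11.2))] -/
theorem re_LSeries₂_le_heckeL (h4 : 4 ∣ M) (χ : MulChar (GaussQuot M) ℂ) {k : ℕ} (hk : k ≠ 0)
    {s : ℂ} (hs : 1 < s.re) (hs2 : s.re ≤ 2) :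
    (LSeries (lCoeffP (psiSq (psi M χ k))) s).re ≤
      C2 * (Real.log ((M : ℝ) * (k + 2)) + Real.log (|s.im| + 4)) := by
  have h2k : 2 * k ≠ 0 := by omega
  have pkg := logDerivPackage_heckeL h4 (χ ^ 2) h2k
  have hmaj : ∀ n, ‖lCoeffP (psi M (χ ^ 2) (2 * k)) n‖ ≤ Lam0 n :=
    norm_lCoeffP_le_Lam0 (fun z _ ↦ norm_psi_le_one (χ ^ 2) (2 * k) z)
  have h := pkg.re_LSeries_le_of_majorant K0_nonneg hmaj (fun s hs ↦ LSeriesSummable_Lam0 hs)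
    (fun σ hσ hσ2 ↦ re_LSeries_Lam0_le hσ hσ2) s hs hs2
  rw [psiSq_psi]
  have hcast : ((M : ℝ) * ((2 * k : ℕ) + 2)) = ((M : ℝ) * (((2 * k : ℕ) : ℝ) + 2)) := by push_cast; ring
  have hE : (8 * (2 * (3 : ℝ) + |Real.log (nS / (((4 : ℝ) ^ 6 * nS)⁻¹ * ((1 : ℝ) / 32)))| + 1) / ((1 : ℝ) / 4)) +
      32 / (3 * (1 : ℝ)) + K0 = C2 / 2 := by unfold C2 Epkg; ring
  rw [hE] at h
  have hC2 := C2_nonneg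
  have hlog := log_Q2_le (M := M) k s.im
  have hℓ : 0 ≤ Real.log ((M : ℝ) * (((2 * k : ℕ) : ℝ) + 2)) + Real.log (|s.im| + 4) := by
    have : (0 : ℝ) ≤ ((2 * k : ℕ) : ℝ) := Nat.cast_nonneg _
    have hM1 : (1 : ℝ) ≤ M := by exact_mod_cast Nat.one_le_iff_ne_zero.mpr (NeZero.ne M)
    have h1 : 0 ≤ Real.log ((M : ℝ) * (((2 * k : ℕ) : ℝ) + 2)) := Real.log_nonneg (by nlinarith)
    have h2 : 0 ≤ Real.log (|s.im| + 4) := Real.log_nonneg (by linarith [abs_nonneg s.im])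
    linarith
  calc (LSeries (lCoeffP (psi M (χ ^ 2) (2 * k))) s).re
      ≤ C2 / 2 * (Real.log ((M : ℝ) * (((2 * k : ℕ) : ℝ) + 2)) + Real.log (|s.im| + 4)) := h
    _ ≤ C2 / 2 * (2 * (Real.log ((M : ℝ) * (k + 2)) + Real.log (|s.im| + 4))) := by
        apply mul_le_mul_of_nonneg_left _ (by linarith)
        have := hlog
        push_cast at this ⊢
        linarith
    _ = C2 * (Real.log ((M : ℝ) * (k + 2)) + Real.log (|s.im| + 4)) := by ring

/-- **The zero-free-region datum for `L(s, ψ)`, `k ≥ 1`** (`TwistedZFRData` with `η = 1`, `A = 3`,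
`C_g = S`, `c₁ = (4⁶S)⁻¹`, `K₀`, `C₂` ABSOLUTE; `pole = false`; `Q = M(k+2)`; `Λ₀` the odd-ideal von
Mangoldt function, `Λ₁ = l_ψ`, `Λ₂ = l_{ψ²}`, `F = heckeL M χ k`). [cite: MontgomeryVaughan2007, §11.1 Theorem 11.3 (hypotheses)] -/
theorem twistedZFRData_heckeL (h4 : 4 ∣ M) (χ : MulChar (GaussQuot M) ℂ) {k : ℕ} (hk : k ≠ 0) :
    TwistedZFRData 1 3 nS ((4 : ℝ) ^ 6 * nS)⁻¹ K0 C2 false ((M : ℝ) * (k + 2))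
      Lam0 (lCoeffP (psi M χ k)) (lCoeffP (psiSq (psi M χ k))) (heckeL M χ k) where
  eta_pos := one_pos
  eta_le_one := le_rfl
  A_nonneg := by norm_num
  Cg_pos := nS_pos
  c₁_pos := by have := nS_pos; positivity
  K₀_nonneg := K0_nonneg
  C₂_nonneg := C2_nonneg
  one_le_Q := (logDerivPackage_heckeL h4 χ hk).one_le_Q
  nonneg := Lam0_nonneg
  summable := fun s hs ↦ LSeriesSummable_Lam0 hs
  re_LSeries₀_le := fun σ hσ hσ2 ↦ re_LSeries_Lam0_le hσ hσ2
  norm_le₁ := norm_lCoeffP_le_Lam0 (fun z _ ↦ norm_psi_le_one χ k z)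
  norm_le₂ := norm_lCoeffP_le_Lam0 (fun z hz ↦ by
    rw [psiSq, norm_pow]; exact pow_le_one₀ (norm_nonneg _) (norm_psi_le_one χ k z))
  three_four_one := fun σ hσ t ↦ three_four_one (fun z _ ↦ norm_psi_le_one χ k z)
    (fun z hz ↦ psi_zero_or_norm_one χ k hz.ne_zero) hσ t
  differentiableOn := (differentiable_heckeL χ hk).differentiableOn
  ne_zero := fun s hs ↦ heckeL_ne_zero h4 χ k hs
  logDeriv_eq := fun s hs ↦ by rw [deriv_heckeL_div h4 χ k hs]; rfl
  growth := fun s hs1 hs3 ↦ growth_heckeL χ hk (by linarith) hs3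
  lower := fun s hs hs2 ↦ lower_heckeL h4 χ k hs hs2
  re_LSeries₂_le := fun s hs hs2 ↦ by
    simpa using re_LSeries₂_le_heckeL h4 χ hk hs hs2
  reflect := fun h ↦ absurd h (by decide)

/-- **The zero-free region (16.20) for `L(s, ψ)`, `ψ = χ(z)(z/|z|)^k`, `k ≥ 1`, uniformly in the modulus
and the frequency**: there is an ABSOLUTE `c > 0` such that for every `M` with `4 ∣ M`, every character
`χ` of `(ℤ[i]/M)ˣ`, every `k ≥ 1`, `L(s, ψ)` has no zero `ρ = β + iγ` with
`β > 1 - c/(log(M(k+2)) + log(|γ| + 4))` (Friedlander–Iwaniec: "no zeros … with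
`σ > 1 - c/log(4d + |m| + |t|)`"; for `k ≥ 1` there is no exceptional real zero since `ψ² ≠ 1`).
[cite: FriedlanderIwaniecAnnals1998, (16.20)] -/
theorem exists_zeroFree_heckeL :
    ∃ c : ℝ, 0 < c ∧ ∀ (M : ℕ) [NeZero M], 4 ∣ M → ∀ (χ : MulChar (GaussQuot M) ℂ) (k : ℕ), k ≠ 0 →
      ∀ ρ : ℂ, heckeL M χ k ρ = 0 →
        ρ.re ≤ 1 - c / (Real.log ((M : ℝ) * (k + 2)) + Real.log (|ρ.im| + 4)) := by
  obtain ⟨c, hc, h⟩ := TwistedZFRData.exists_zeroFree_const (η := 1) (A := 3) (Cg := nS)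
    (c₁ := ((4 : ℝ) ^ 6 * nS)⁻¹) (K₀ := K0) (C₂ := C2) one_pos (by norm_num) K0_nonneg C2_nonneg
  refine ⟨c, hc, fun M _ h4 χ k hk ρ hρ ↦ le_of_not_gt fun hlt ↦ ?_⟩
  have := h false _ _ _ _ _ (twistedZFRData_heckeL h4 χ hk) ρ hρ hlt
  exact absurd this.1 (by decide)

end GaussianCosetTheta

end Literature.NumberTheory.LFunctions
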